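import Literature.NumberTheory.Transcendental.AnalytificationFunctorialityProofs
import HarnessLib

/-!
# Algebraic coordinates have dual tangent vectors on an analytification

Let `φ : M → Y(ℂ)` be an analytification (`IsAnalytification E Y d φ`, holomorphic atlas on `M`)
of a smooth `k`-scheme `Y` (`k ⊆ ℂ`) of relative dimension `d`, let `V ⊆ Y` be an affine open with
a SUBMERSIVE PRESENTATION `Γ(Y, V) = k[xᵢ : i ∈ ι]/(fⱼ : j ∈ σ)` of dimension `d`
(distinguished variables `x_{c(j)}`, Jacobian a unit), and let `P ∈ M` with `φ(P) ∈ V`. Then the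
FREE coordinate functions `xᵢ ∘ φ` (`i ∉ c(σ)`), read in the chart of `M` at `P`, have
differentials at `P` admitting DUAL VECTORS `w_b`:
`D(x_a ∘ φ ∘ χ⁻¹)(χ P) · w_b = δ_{ab}` (`IsAnalytification.exists_dual_fderiv_coord`).

This is Serre's «au voisinage d'un point simple, les coordonnées locales sont des fonctions
régulières» (GAGA §1 n°4, §2 n°6 Cor. 2) for the tree's extrinsic analytification predicate,
which records only that regular functions are holomorphic: the free coordinates are injective
near `P` by the uniqueness half of the implicit function theorem for the relations
(`exists_isOpen_injOn_of_det_ne_zero`), hence — Clements–Osgood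
(`Literature.Analysis.Complex.SCV.bijective_fderiv_of_injOn`) — their joint differential
`T_P M → ℂ^{free}` is bijective, and the dual vectors are the preimages of the standard basis.
The argument is steps 2–4 of `IsAnalytification.mdifferentiable_comp_map_holds`, isolated as a
statement about ONE analytification; it is the input "differentials of regular functions span the
cotangent space" of the injectivity of algebraic into analytic differential forms.

## References

* J.-P. Serre, *Géométrie algébrique et géométrie analytique*, Ann. Inst. Fourier 6 (1956),
  §1 n°4, §2 n°5 Prop. 2, n°6 Prop. 3 Cor. 2.
* K. Fritzsche, H. Grauert, *From Holomorphic Functions to Complex Manifolds* (2002), Ch. I §8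
  Thm. 8.5.
-/

noncomputable section

universe u

open CategoryTheory AlgebraicGeometry Topology Filter
open scoped Manifold ContDiff

namespace Literature.NumberTheory.Transcendental

namespace IsAnalytification

variable {E : Type*} [NormedAddCommGroup E] [NormedSpace ℂ E] [FiniteDimensional ℂ E]
  {M : Type*} [TopologicalSpace M] [ChartedSpace E M]
  {k : Type} [Field k] [Algebra k ℂ] {Y : Literature.AlgebraicGeometry.Motives.SchemeOver k} {d : ℕ}
  {φ : M → Literature.AlgebraicGeometry.Motives.ComplexPoints Y}

/-- **Free algebraic coordinates have dual tangent vectors.** For an analytification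
`φ : M → Y(ℂ)` with holomorphic atlas of a smooth `k`-scheme `Y` of relative dimension `d`, an
affine open `V` with a submersive presentation `Pres` of `Γ(Y, V)` over `Γ(Spec k, 𝒪) = k` of
dimension `d`, and a point `P` with `φ(P) ∈ V`: there are vectors `w_b ∈ E`, indexed by the free
variables `b ∉ range Pres.map`, such that the real differential at `χ(P)` of the free coordinate
`x_a ∘ φ` read in the chart `χ = chartAt E P` takes the value `δ_{ab}` on `w_b`. (The joint
differential of the free coordinates is a `ℂ`-linear bijection `E → ℂ^{free}` by Clements–Osgood;
take preimages of the standard basis.)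
[cite: SerreGAGA1956, §2 n°6 Prop. 3 Cor. 2 (with §1 n°4)] -/
theorem exists_dual_fderiv_coord [LocallyOfFiniteType Y.hom] [SmoothOfRelativeDimension d Y.hom]
    [IsManifold 𝓘(ℂ, E) ω M] (hφ : IsAnalytification E Y d φ)
    {V : Y.left.Opens} (hV : IsAffineOpen V) (e : V ≤ Y.hom ⁻¹ᵁ ⊤)
    [Algebra Γ(Spec (.of k), ⊤) Γ(Y.left, V)]
    (halg : algebraMap Γ(Spec (.of k), ⊤) Γ(Y.left, V) = (Y.hom.appLE ⊤ V e).hom)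
    {ι σ : Type*} [Fintype ι] [Fintype σ] [DecidableEq ι] [DecidableEq σ]
    (Pres : Algebra.SubmersivePresentation Γ(Spec (.of k), ⊤) Γ(Y.left, V) ι σ)
    (hdim : Pres.dimension = d) {P : M} (hP : (φ P).pt ∈ V) :
    ∃ w : {i : ι // i ∉ Set.range Pres.map} → E,
      ∀ a b : {i : ι // i ∉ Set.range Pres.map},
        fderiv ℝ (fun z ↦ Literature.AlgebraicGeometry.Motives.AlgPoints.evalOrZero V (Pres.val a.1)
          (φ ((chartAt E P).symm z))) (chartAt E P P) (w b) = if a = b then 1 else 0 := by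
  classical
  haveI : IsManifold 𝓘(ℂ, E) 1 M := inferInstance
  haveI : CompleteSpace E := FiniteDimensional.complete ℂ E
  have hφinj : Function.Injective φ := hφ.isHomeomorph.injective
  -- the relations over `ℂ` and the coordinate functions on `Y(ℂ)`
  set F : σ → MvPolynomial ι ℂ := fun j ↦
    MvPolynomial.map ((algebraMap k ℂ).comp (Scheme.ΓSpecIso (.of k)).hom.hom) (Pres.relation j)
    with hF
  set xf : ι → Literature.AlgebraicGeometry.Motives.ComplexPoints Y → ℂ := fun i ↦
    Literature.AlgebraicGeometry.Motives.AlgPoints.evalOrZero V (Pres.val i) with hxf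
  set Q : Literature.AlgebraicGeometry.Motives.ComplexPoints Y := φ P with hQdef
  have hQV : Q.pt ∈ V := hP
  /- (algebra) `x : V(ℂ) → ℂ^ι` is injective, lands in the zero set of the `F j`, and the Jacobian
  of the `F j` in the distinguished variables does not vanish at `x(Q)`. -/
  have hrel : ∀ R : Literature.AlgebraicGeometry.Motives.ComplexPoints Y, R.pt ∈ V →
      ∀ j, MvPolynomial.eval (fun i ↦ xf i R) (F j) = 0 := by
    intro R hR j
    have := Literature.AlgebraicGeometry.Motives.AlgPoints.eval_map_relation e halg
      Pres.toPresentation R hR j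
    simp only [hxf, Literature.AlgebraicGeometry.Motives.AlgPoints.evalOrZero_of_mem _ hR]
    exact this
  have hinjV : ∀ R R' : Literature.AlgebraicGeometry.Motives.ComplexPoints Y, R.pt ∈ V →
      R'.pt ∈ V → (∀ i, xf i R = xf i R') → R = R' := by
    intro R R' hR hR' hx
    refine Literature.AlgebraicGeometry.Motives.AlgPoints.ext_of_forall_eval_val_eq hV e halg
      Pres.toGenerators hR hR' fun i ↦ ?_
    have := hx i
    simp only [hxf] at this
    rwa [Literature.AlgebraicGeometry.Motives.AlgPoints.evalOrZero_of_mem _ hR,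
      Literature.AlgebraicGeometry.Motives.AlgPoints.evalOrZero_of_mem _ hR'] at this
  have hdet : (Matrix.of fun i j : σ ↦ MvPolynomial.eval (fun l ↦ xf l Q)
      (MvPolynomial.pderiv (Pres.map i) (F j))).det ≠ 0 := by
    have := Literature.AlgebraicGeometry.Motives.AlgPoints.det_eval_pderiv_relation_ne_zero e halg
      Pres Q hQV
    simp only [hxf, Literature.AlgebraicGeometry.Motives.AlgPoints.evalOrZero_of_mem _ hQV]
    exact this
  /- (implicit functions) the free coordinates `xᵢ ∘ φ`, `i ∉ c(σ)`, are injective on a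
  neighbourhood `N₁` of `P`. -/
  obtain ⟨W, hWo, hcW, hWinj⟩ :=
    exists_isOpen_injOn_of_det_ne_zero Pres.map Pres.map_inj F (fun l ↦ xf l Q) hdet
  set N₁ : Set M := φ ⁻¹' {R | R.pt ∈ V} ∩ (fun m'' ↦ fun l ↦ xf l (φ m'')) ⁻¹' W with hN₁
  have hN₁o : IsOpen N₁ := by
    refine ContinuousOn.isOpen_inter_preimage ?_ (hφ.isOpen_preimage V) hWo
    refine continuousOn_pi.2 fun l ↦ ?_
    exact (Literature.AlgebraicGeometry.Motives.AlgPoints.continuousOn_evalOrZero V (Pres.val l)).comp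
      hφ.isHomeomorph.continuous.continuousOn fun m'' hm'' ↦ hm''
  have hmN₁ : P ∈ N₁ := ⟨hQV, hcW⟩
  have hinjN₁ : ∀ m₁ ∈ N₁, ∀ m₂ ∈ N₁,
      (∀ i : {i : ι // i ∉ Set.range Pres.map}, xf i.1 (φ m₁) = xf i.1 (φ m₂)) → m₁ = m₂ := by
    intro m₁ hm₁ m₂ hm₂ hfree
    apply hφinj
    refine hinjV _ _ hm₁.1 hm₂.1 fun i ↦ ?_
    have key := hWinj _ hm₁.2 _ hm₂.2 (fun i hi ↦ hfree ⟨i, hi⟩)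
      (fun j ↦ by rw [hrel _ hm₁.1, hrel _ hm₂.1])
    exact congrFun key i
  /- (Osgood) in the chart `χ` of `M` at `P`, `T = x_free ∘ φ ∘ χ⁻¹` is an injective holomorphic
  map between open subsets of equidimensional spaces, so its differential at `χ P` is bijective. -/
  set χ : OpenPartialHomeomorph M E := chartAt E P with hχ
  set O : Set E := χ.target ∩ χ.symm ⁻¹' N₁ with hO
  have hOo : IsOpen O := χ.isOpen_inter_preimage_symm hN₁o
  set T : E → ({i : ι // i ∉ Set.range Pres.map} → ℂ) :=
    fun z i ↦ xf i.1 (φ (χ.symm z)) with hT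
  have hz₀ : χ P ∈ O :=
    ⟨χ.map_source (mem_chart_source E P), by
      show χ.symm (χ P) ∈ N₁
      rw [χ.left_inv (mem_chart_source E P)]
      exact hmN₁⟩
  have hyM : ∀ i, MDifferentiableOn 𝓘(ℂ, E) 𝓘(ℂ, ℂ) (fun m'' ↦ xf i (φ m''))
      (φ ⁻¹' {R | R.pt ∈ V}) :=
    fun i ↦ hφ.mdifferentiableOn_evalOrZero ⟨V, hV⟩ (Pres.val i)
  have hTa : ∀ (a : {i : ι // i ∉ Set.range Pres.map}) (z : E), z ∈ O →
      DifferentiableAt ℂ (fun z ↦ T z a) z := by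
    intro a z hz
    have h1 : MDifferentiableAt 𝓘(ℂ, E) 𝓘(ℂ, ℂ) (fun m'' ↦ xf a.1 (φ m'')) (χ.symm z) :=
      (hyM a.1).mdifferentiableAt ((hφ.isOpen_preimage _).mem_nhds hz.2.1)
    have h2 : MDifferentiableAt 𝓘(ℂ, E) 𝓘(ℂ, E) χ.symm z :=
      mdifferentiableAt_atlas_symm (chart_mem_atlas E P) hz.1
    exact mdifferentiableAt_iff_differentiableAt.1 (h1.comp z h2)
  have hTd : DifferentiableOn ℂ T O := by
    intro z hz
    exact (differentiableAt_pi.2 fun a ↦ hTa a z hz).differentiableWithinAt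
  have hTinj : Set.InjOn T O := by
    intro z hz z' hz' hzz'
    have : χ.symm z = χ.symm z' := hinjN₁ _ hz.2 _ hz'.2 fun i ↦ congrFun hzz' i
    rw [← χ.right_inv hz.1, ← χ.right_inv hz'.1, this]
  have hcard : Fintype.card {i : ι // i ∉ Set.range Pres.map} = d := by
    rw [Fintype.card_subtype_compl]
    change Fintype.card ι - Fintype.card (Set.range Pres.map) = d
    rw [Set.card_range_of_injective Pres.map_inj, ← hdim, Algebra.Presentation.dimension,
      Nat.card_eq_fintype_card, Nat.card_eq_fintype_card]
  have hdimE : Module.finrank ℂ E =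
      Module.finrank ℂ ({i : ι // i ∉ Set.range Pres.map} → ℂ) := by
    rw [hφ.finrank_eq, Module.finrank_fintype_fun_eq_card, hcard]
  have hbij := Literature.Analysis.Complex.SCV.bijective_fderiv_of_injOn hdimE hTd hOo hTinj hz₀
  set Λ : E ≃L[ℂ] ({i : ι // i ∉ Set.range Pres.map} → ℂ) :=
    ContinuousLinearEquiv.ofBijective (fderiv ℂ T (χ P)) (LinearMap.ker_eq_bot.2 hbij.1)
      (LinearMap.range_eq_top.2 hbij.2) with hΛ
  -- the dual vectors: preimages of the standard basis under the joint differential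
  refine ⟨fun b ↦ Λ.symm (Pi.single b 1), fun a b ↦ ?_⟩
  have hTdiff : DifferentiableAt ℂ T (χ P) := (hTd _ hz₀).differentiableAt (hOo.mem_nhds hz₀)
  -- the `a`-th component of the joint differential is the differential of the `a`-th coordinate
  have hcomp : fderiv ℝ (fun z ↦ T z a) (χ P) =
      ((ContinuousLinearMap.proj (R := ℂ) (φ := fun _ : {i : ι // i ∉ Set.range Pres.map} ↦ ℂ)
        a).comp (fderiv ℂ T (χ P))).restrictScalars ℝ := by
    have h1 := ((ContinuousLinearMap.proj (R := ℂ)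
      (φ := fun _ : {i : ι // i ∉ Set.range Pres.map} ↦ ℂ) a).hasFDerivAt).comp (χ P)
        hTdiff.hasFDerivAt
    exact (h1.restrictScalars ℝ).fderiv
  have hTz : (fun z ↦ T z a) = fun z ↦
      Literature.AlgebraicGeometry.Motives.AlgPoints.evalOrZero V (Pres.val a.1)
        (φ ((chartAt E P).symm z)) := rfl
  rw [← hTz, hcomp]
  simp only [ContinuousLinearMap.coe_restrictScalars', ContinuousLinearMap.coe_comp,
    Function.comp_apply, ContinuousLinearMap.proj_apply]
  have hΛT : fderiv ℂ T (χ P) (Λ.symm (Pi.single b 1)) = Pi.single b 1 :=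
    calc fderiv ℂ T (χ P) (Λ.symm (Pi.single b 1))
        = Λ (Λ.symm (Pi.single b 1)) := by rw [hΛ]; rfl
      _ = Pi.single b 1 := Λ.apply_symm_apply _
  rw [hΛT, Pi.single_apply]

end IsAnalytification

end Literature.NumberTheory.Transcendental

end
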